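/-
Origin: expansion seat `prover-pub-hodgecm-own-htheta-0`, handover #H6 2026-08-21T05:15Z md5 1be7bcd9a4d9 (146 l.; NEW additive KERNEL leaf beside E; imports #H1 `HodgeCM.Model.LiuIndexMuLiu` (RUN 72) + carch `HodgeCM.Model.ArchKTypeOfOrient` (landed); ns HodgeCM.Model.LiuIndex; 11 theorems 0 defs 0 records 0 `def … : Prop`: the recipe of record AGAINST THE PLACE'S BLOCK SIGN — id branch `ι₁ ∈ Φ^δ(a) ↔ 0 < cmXW … (cmPlace ι₁) 0` (carch `cmXW_pos_iff_of_embedding_eq`), conj branch `↔ cmXW … < 0`, and embedding-free `muLiu ῑ₁ ρ = −muLiu ι₁ ρ` — the kernel form of MU0-TABLE.md §3 (i), the reason for #H4∕#H5 r6's guard; drop alone; NAMES for audit: HodgeCM.Model.LiuIndex.muLiu_conjugate · HodgeCM.Model.LiuIndex.muLiu_mk_eq_neg_iff_cmXW_pos_of_embedding_eq · HodgeCM.Model.LiuIndex.muLiu_mk_eq_neg_iff_cmXW_neg_of_embedding_ne) (`HOME/pub-hodgecm-own-htheta/stage73/HodgeCM/Model/LiuIndexMuLiuOrient.lean`, md5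 1be7bcd9a4d9, 146 lines);
landed by the gen-31 packager (p-g31) in gate run 73 as `HodgeCM/Model/LiuIndexMuLiuOrient.lean` (verbatim).
-/
/-
Copyright (c) 2026 the pub-hodgecm formalisation cell (harness21).  New file, not vendored.
Origin: ROW-9 OWNER seat `prover-pub-hodgecm-own-htheta-0` (unit pub-hodgecm-own-htheta, named single owner of binder row 9 `hΘ`),
2026-08-21.  Target in PKG: `HodgeCM/Model/LiuIndexMuLiuOrient.lean` (NEW additive KERNEL leaf beside E; imports this seat's #H1
`HodgeCM.Model.LiuIndexMuLiu` (RUN 72) and carch's landed `HodgeCM.Model.ArchKTypeOfOrient`; nothing imports it; outside E's import closure;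
E untouched; MODEL-N ±0).  KERNEL ONLY: theorems, 0 defs, 0 records, nothing cited, 0 `def … : Prop`.
Nothing here is a claim of the manuscripts under adjudication.
-/
import Summits.HodgeConjecture.HodgeCM.Model.LiuIndexMuLiu
import Summits.HodgeConjecture.HodgeCM.Model.ArchKTypeOfOrient

set_option autoImplicit false

/-!
# The recipe of record `LiuIndex.muLiu` AGAINST THE PLACE'S BLOCK SIGN — why the cited sentences are owed at the embedding of record only

`muLiu ι₁ ρ q = ∓𝟙_{w₁}` is keyed on `ι₁ ∈ Φ^δ(q)` ⟺ `0 < re ι₁(a) · im ι₁(δ_L)` (`a` a Gram scalar of `q`; `mem_lineType_iff_mul_pos`), a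
predicate of the EMBEDDING `ι₁`.  The archimedean central types that compatible splittings of the pair `(V, ⟨a⟩)` can have at `w₁` are
governed by the BLOCK SIGN of the line at the place, `0 < cmXW L (frameD V) (lineVec a) _ ι₁ (cmPlace ι₁) 0 = re ι₁(a) ∕ im ((mk ι₁).embedding δ_L)`
(carch `ArchSideTerm.cmXW_cmPlace_lineVec`; the tree pins `e_P − e_Q = |R′| − |S′|` there, `HypCensus.placeVacExponents_eP_sub_eQ`), a predicate
of the PLACE's Mathlib-chosen embedding `(InfinitePlace.mk ι₁).embedding ∈ {ι₁, ῑ₁}`.  This file records, in the kernel: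
* **ID BRANCH** (`(mk ι₁).embedding = ι₁`, the guard every E binder carries): `ι₁ ∈ Φ^δ(a)` ⟺ the block sign is POSITIVE
  (`mem_lineType_iff_cmXW_pos_of_embedding_eq`), so `muLiu ι₁ ρ ⟦a⟧ = −𝟙_{w₁}` exactly over the block-positive classes
  (`muLiu_mk_eq_neg_iff_cmXW_pos_of_embedding_eq`) — the table of `pub-hodgecm-own-htheta/MU0-TABLE.md` §3;
* **CONJ BRANCH** (`(mk ι₁).embedding ≠ ι₁`): `ι₁ ∈ Φ^δ(a)` ⟺ the block sign is NEGATIVE (`mem_lineType_iff_cmXW_neg_of_embedding_ne`,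
  `muLiu_mk_eq_neg_iff_cmXW_neg_of_embedding_ne`) — the table is the exact INVERSE of the id-branch one;
* embedding-free form: **`muLiu ῑ₁ ρ = − muLiu ι₁ ρ`** (`muLiu_conjugate`; the place term `𝟙_{w₁}` is the same for both embeddings,
  `placeIndicator_conjugate`, and a CM type contains exactly one of `ι₁, ῑ₁`).
CONSEQUENCE (r6 of this seat's E-shaped siblings «…J ∕ JU ∕ JUAR ∕ JUARM», STATUS 2026-08-21T05:05:23Z): a `hcite` binder over the pinned
dictionary at `μ₀ := muLiu ι₁ rep` is quantified `∀ {L ι₁} (V), (InfinitePlace.mk ι₁).embedding = ι₁ → ∀ a₀, …`; over the other embedding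
of the place the N-i1-match was never made and the table is inverted.  All `[folklore]`.
-/

noncomputable section

open NumberField NumberField.InfinitePlace NumberField.ComplexEmbedding
open scoped Matrix Classical
open Literature.NumberTheory.Automorphic Literature.NumberTheory.Automorphic.UnitaryGroup Literature.NumberTheory.Weil1964
open Literature.NumberTheory.GelbartRogawski1991 Literature.NumberTheory.GelbartRogawski1991.UnitaryDualPair
open Literature.AlgebraicGeometry.ShimuraVarieties (conjRingHomK)

namespace HodgeCM.Model

open HodgeCM.SignRecipe (lineType)
open HodgeCM.Model.HypCensus (cmXW)

namespace LiuIndex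

variable {L : CMField} {ι₁ : (L : Type) →+* ℂ} {ρ : GramClass L → RealScalar L}

/-! ## §1 `Φ^δ`-membership in closed form and under conjugation -/

/-- `ι₁ ∈ Φ^δ(a) ↔ 0 < re ι₁(a) · im ι₁(δ_L)` (`η_L = δ_L`, `SignRecipe.eta_eq_imagUnit`; `im ι₁(η a) = im ι₁(η) · re ι₁(a)`). [folklore] -/
theorem mem_lineType_iff_mul_pos (a : RealScalar L) :
    ι₁ ∈ (lineType a.1 a.2.1 a.2.2).1 ↔ 0 < (ι₁ a.1).re * (ι₁ (imagUnit (L : Type))).im := by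
  rw [SignRecipe.mem_lineType_iff, SignRecipe.im_embedding_eta_mul, SignRecipe.eta_eq_imagUnit, mul_comm]

/-- a CM type contains exactly one of `ι₁`, `ῑ₁`: `ῑ₁ ∈ Φ^δ(a) ↔ ι₁ ∉ Φ^δ(a)`. [folklore] -/
theorem conjugate_mem_lineType_iff (a : RealScalar L) :
    conjugate ι₁ ∈ (lineType a.1 a.2.1 a.2.2).1 ↔ ι₁ ∉ (lineType a.1 a.2.1 a.2.2).1 := by
  have h := (lineType a.1 a.2.1 a.2.2).2 ι₁
  constructor
  · exact fun hc hι => (h.mp hι) hc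
  · intro hι
    by_contra hc
    exact hι (h.mpr hc)

/-! ## §2 The place data do not see the embedding -/

/-- the real place of `L⁺` under `ῑ₁` is the one under `ι₁`. [folklore] -/
theorem cmPlace_conjugate : HypCensus.cmPlace (L : Type) (conjugate ι₁) = HypCensus.cmPlace (L : Type) ι₁ := by
  apply Subtype.ext
  show (InfinitePlace.mk (conjugate ι₁)).comap _ = (InfinitePlace.mk ι₁).comap _
  rw [mk_conjugate_eq]

/-- the place term `𝟙_{w₁}` is the same for `ι₁` and `ῑ₁`. [folklore] -/
theorem placeIndicator_conjugate : placeIndicator (conjugate ι₁) = placeIndicator ι₁ := by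
  unfold placeIndicator
  rw [cmPlace_conjugate]

/-- `𝟙_{w₁} ≠ −𝟙_{w₁}`. [folklore] -/
theorem placeIndicator_ne_neg : placeIndicator ι₁ ≠ -placeIndicator ι₁ := by
  intro h
  have h1 := congr_fun h (cmPlaceOver (L : Type) (HypCensus.cmPlace (L : Type) ι₁)).1
  simp only [placeIndicator, Pi.neg_apply, Pi.single_eq_same] at h1
  omega

/-! ## §3 The table under conjugation of the embedding: INVERTED -/

/-- **`muLiu ῑ₁ ρ q = − muLiu ι₁ ρ q`** for every class `q` and every section `ρ`. [folklore] -/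
theorem muLiu_conjugate (ρ : GramClass L → RealScalar L) (q : GramClass L) :
    muLiu (conjugate ι₁) ρ q = -muLiu ι₁ ρ q := by
  have hS := (lineType (GramClass.scalar ρ q) (GramClass.conj_scalar ρ q) (GramClass.scalar_ne ρ q)).2 ι₁
  unfold muLiu
  rw [placeIndicator_conjugate]
  by_cases h : ι₁ ∈ (lineType (GramClass.scalar ρ q) (GramClass.conj_scalar ρ q) (GramClass.scalar_ne ρ q)).1
  · rw [if_pos h, if_neg (hS.mp h), neg_neg]
  · rw [if_neg h, if_pos (not_not.mp fun hn => h (hS.mpr hn))]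

/-- `muLiu ι₁ ρ ⟦a⟧ = −𝟙_{w₁} ↔ ι₁ ∈ Φ^δ(a)` (the table takes the two DISTINCT values `∓𝟙_{w₁}`). [folklore] -/
theorem muLiu_mk_eq_neg_iff_mem (hρ : ∀ q, GramClass.mk (ρ q) = q) (a : RealScalar L) :
    muLiu ι₁ ρ (GramClass.mk a) = -placeIndicator ι₁ ↔ ι₁ ∈ (lineType a.1 a.2.1 a.2.2).1 := by
  refine ⟨fun h => ?_, fun h => muLiu_mk_of_mem hρ a h⟩
  by_contra hn
  rw [muLiu_mk_of_not_mem hρ a hn] at h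
  exact placeIndicator_ne_neg h

/-! ## §4 Against the block sign of the line at the place (carch `cmXW_cmPlace_lineVec`) -/

variable (V : HermSpace3 L ι₁)

/-- **ID BRANCH**: at the embedding of record, `ι₁ ∈ Φ^δ(a)` iff the line `⟨a⟩` is block-POSITIVE at `w₁`
(carch `cmXW_pos_iff_of_embedding_eq`). [folklore] -/
theorem mem_lineType_iff_cmXW_pos_of_embedding_eq (heq : (InfinitePlace.mk ι₁).embedding = ι₁) (a : RealScalar L) :
    ι₁ ∈ (lineType a.1 a.2.1 a.2.2).1 ↔
      0 < cmXW (L : Type) (frameD V) (RealScalar.vec a) (RealScalar.vec_real a) ι₁ (HypCensus.cmPlace (L : Type) ι₁) 0 := by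
  rw [mem_lineType_iff_mul_pos, cmXW_pos_iff_of_embedding_eq V heq a.1 a.2.1]

/-- **CONJ BRANCH**: at the OTHER embedding of the place, `ι₁ ∈ Φ^δ(a)` iff the line `⟨a⟩` is block-NEGATIVE at `w₁`. [folklore] -/
theorem mem_lineType_iff_cmXW_neg_of_embedding_ne (hne : (InfinitePlace.mk ι₁).embedding ≠ ι₁) (a : RealScalar L) :
    ι₁ ∈ (lineType a.1 a.2.1 a.2.2).1 ↔
      cmXW (L : Type) (frameD V) (RealScalar.vec a) (RealScalar.vec_real a) ι₁ (HypCensus.cmPlace (L : Type) ι₁) 0 < 0 := by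
  rw [mem_lineType_iff_mul_pos,
    show cmXW (L : Type) (frameD V) (RealScalar.vec a) (RealScalar.vec_real a) ι₁ (HypCensus.cmPlace (L : Type) ι₁) 0 =
        (ι₁ a.1).re / ((InfinitePlace.mk ι₁).embedding (imagUnit (L : Type))).im from ArchSideTerm.cmXW_cmPlace_lineVec V a.1 a.2.1,
    im_embedding_imagUnit_of_ne hne, div_neg, neg_lt_zero, div_pos_iff, mul_pos_iff]

/-- **the recipe of record reads `−𝟙_{w₁}` EXACTLY over the block-positive classes — at the embedding of record.** [folklore] -/
theorem muLiu_mk_eq_neg_iff_cmXW_pos_of_embedding_eq (hρ : ∀ q, GramClass.mk (ρ q) = q)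
    (heq : (InfinitePlace.mk ι₁).embedding = ι₁) (a : RealScalar L) :
    muLiu ι₁ ρ (GramClass.mk a) = -placeIndicator ι₁ ↔
      0 < cmXW (L : Type) (frameD V) (RealScalar.vec a) (RealScalar.vec_real a) ι₁ (HypCensus.cmPlace (L : Type) ι₁) 0 := by
  rw [muLiu_mk_eq_neg_iff_mem hρ a, mem_lineType_iff_cmXW_pos_of_embedding_eq V heq a]

/-- **… and EXACTLY over the block-NEGATIVE classes at the other embedding** (the inverted table). [folklore] -/
theorem muLiu_mk_eq_neg_iff_cmXW_neg_of_embedding_ne (hρ : ∀ q, GramClass.mk (ρ q) = q)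
    (hne : (InfinitePlace.mk ι₁).embedding ≠ ι₁) (a : RealScalar L) :
    muLiu ι₁ ρ (GramClass.mk a) = -placeIndicator ι₁ ↔
      cmXW (L : Type) (frameD V) (RealScalar.vec a) (RealScalar.vec_real a) ι₁ (HypCensus.cmPlace (L : Type) ι₁) 0 < 0 := by
  rw [muLiu_mk_eq_neg_iff_mem hρ a, mem_lineType_iff_cmXW_neg_of_embedding_ne V hne a]

end LiuIndex

end HodgeCM.Model

end
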